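import Summits.Ventures.CertifiedArithmetic.LowPrec.ErrorTables
import Summits.Ventures.CertifiedArithmetic.LowPrec.Directed

/-!
# Datum-level `×` / `+` under the four deterministic rounding modes (saturating), for table export

HONEST FRAMING (venture CertifiedArithmetic / cell `pub-lowprec`): certified error envelopes and
provably optimal rounding/accumulation schemes for low-precision formats under stated cost models;
every table by two implementations; no hardware or vendor claims.

`RMode` = {`NE` (ties to even), `TZ` (toward zero), `Down`, `Up`}; `roundMode φ m : ℚ → MiniFloat φ`
dispatches to `roundNE` / `roundTowardZero` / `roundDown` / `roundUp` (all saturating at `±top`: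
OCP `SAT` / P3109 `SatFinite`); `fmulMode` / `faddMode` add the IEEE 754 §6.3 signs of exact-zero
results (product: XOR; sum: `+0`, except `-0` under `Down`, and `x + x` keeps the sign of a zero
`x`). These are the functions whose exhaustive code tables are exported and diffed against the
cell's two enumerators for every (format, op, mode).
-/

namespace Literature.ComputerArithmetic.FloatingPoint

/-- The four deterministic IEEE rounding-direction attributes. [cite: IEEE7542019, §4.3] -/
inductive RMode
  | NE
  | TZ
  | Down
  | Up
  deriving DecidableEq, Repr

/-- Rounding of a rational into `φ` under mode `m` (saturating). [cite: IEEE7542019, §4.3] -/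
def roundMode (φ : Format) : RMode → ℚ → MiniFloat φ
  | .NE => roundNE φ
  | .TZ => roundTowardZero φ
  | .Down => roundDown φ
  | .Up => roundUp φ

namespace MiniFloat

/-- Sign of an exact-zero SUM `a + b = 0` under mode `m`: `-0` iff both operands are negative
zeros, or (operands of opposite signs cancelling / mixed zeros) the mode is `Down`.
[cite: IEEE7542019, §6.3] -/
def zeroSumNeg {φ₁ φ₂ : Format} (m : RMode) (a : MiniFloat φ₁) (b : MiniFloat φ₂) : Bool :=
  (a.neg && b.neg) || ((a.neg != b.neg) && decide (m = RMode.Down))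

/-- `a × b` delivered in `ψ` under mode `m`. [cite: IEEE7542019, §6.3] -/
def fmulMode {φ₁ φ₂ : Format} (ψ : Format) (m : RMode) (a : MiniFloat φ₁) (b : MiniFloat φ₂) :
    MiniFloat ψ :=
  if a.toRat * b.toRat = 0 then signedZero ψ (a.neg != b.neg) else roundMode ψ m (a.toRat * b.toRat)

/-- `a + b` delivered in `ψ` under mode `m`. [cite: IEEE7542019, §6.3] -/
def faddMode {φ₁ φ₂ : Format} (ψ : Format) (m : RMode) (a : MiniFloat φ₁) (b : MiniFloat φ₂) :
    MiniFloat ψ :=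
  if a.toRat + b.toRat = 0 then signedZero ψ (zeroSumNeg m a b) else roundMode ψ m (a.toRat + b.toRat)

/-- Under `NE` the mode operations are `fmul` / `fadd` of `ErrorTables.lean`. [folklore] -/
theorem fmulMode_NE {φ₁ φ₂ : Format} (ψ : Format) (a : MiniFloat φ₁) (b : MiniFloat φ₂) :
    fmulMode ψ RMode.NE a b = fmul ψ a b := rfl

/-- Under `NE` the zero-sum sign rule reduces to "both negative". [folklore] -/
theorem faddMode_NE {φ₁ φ₂ : Format} (ψ : Format) (a : MiniFloat φ₁) (b : MiniFloat φ₂) :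
    faddMode ψ RMode.NE a b = fadd ψ a b := by
  unfold faddMode fadd zeroSumNeg
  cases a.neg <;> cases b.neg <;> simp [roundMode]

/-- Kernel smoke tests of the directed modes on `E2M1`: `5/4 ↦ 1 (TZ), 1 (Down), 3/2 (Up)`;
`-5/4 ↦ -1 (TZ), -3/2 (Down), -1 (Up)`; saturation `±100 ↦ ±6` in every mode; `Up (-1/5) = -0`,
`Down (1/5) = +0`. [folklore] -/
theorem roundMode_E2M1_examples :
    (roundMode Format.E2M1 .TZ (5 / 4)).toRat = 1 ∧ (roundMode Format.E2M1 .Down (5 / 4)).toRat = 1 ∧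
    (roundMode Format.E2M1 .Up (5 / 4)).toRat = 3 / 2 ∧
    (roundMode Format.E2M1 .TZ (-5 / 4)).toRat = -1 ∧
    (roundMode Format.E2M1 .Down (-5 / 4)).toRat = -3 / 2 ∧
    (roundMode Format.E2M1 .Up (-5 / 4)).toRat = -1 ∧
    (roundMode Format.E2M1 .Up 100).toRat = 6 ∧ (roundMode Format.E2M1 .Down (-100)).toRat = -6 ∧
    (roundMode Format.E2M1 .TZ (-100)).toRat = -6 ∧
    (roundMode Format.E2M1 .Up (-1 / 5)).toRat = 0 ∧ (roundMode Format.E2M1 .Up (-1 / 5)).neg = true ∧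
    (roundMode Format.E2M1 .Down (1 / 5)).toRat = 0 ∧
    (roundMode Format.E2M1 .Down (1 / 5)).neg = false := by
  decide +kernel

/-- IEEE OVERFLOW (pre-saturation) under each mode, in the DELIVERED-RESULT reading of IEEE 754
§7.4 used by the cell (FORMATS.md §3): `NE` — `overflowNE` (unbounded-exponent RNE result beyond
`maxRat`); `TZ` — never (toward-zero delivers `±maxRat`); `Up` — exactly when `x > maxRat`
(delivers `+∞`; the negative side delivers `-maxRat`); `Down` — exactly when `x < -maxRat`.
Under the `inf` policy an overflow delivers `±∞`, under OCP `E4M3`'s non-saturating policy NaN;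
under `satfinite` the datum is `roundMode` regardless. [cite: IEEE7542019, §7.4] -/
def overflowMode (φ : Format) : RMode → ℚ → Bool
  | .NE, x => overflowNE φ x
  | .TZ, _ => false
  | .Up, x => decide (φ.maxRat < x)
  | .Down, x => decide (x < -φ.maxRat)

/-- Kernel examples of the directed overflow flags on `E5M2` (`maxRat = 57344`): `TZ` never
overflows; `Up` overflows at `57345` but not at `57344` nor at `-10^6`; `Down` mirrors it.
[folklore] -/
theorem overflowMode_E5M2_examples :
    overflowMode Format.E5M2 .TZ 1000000 = false ∧
    overflowMode Format.E5M2 .Up 57344 = false ∧ overflowMode Format.E5M2 .Up 57345 = true ∧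
    overflowMode Format.E5M2 .Up (-1000000) = false ∧
    overflowMode Format.E5M2 .Down (-57345) = true ∧ overflowMode Format.E5M2 .Down 1000000 = false := by
  decide +kernel

end MiniFloat

end Literature.ComputerArithmetic.FloatingPoint
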